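import Literature.NumberTheory.GaloisRepresentations.IdeleLocalInvariantsInflation
import Literature.NumberTheory.GaloisRepresentations.SemiLocalCompositumBridge
import Literature.NumberTheory.GaloisRepresentations.CyclotomicTowerLocalIndex
import Literature.NumberTheory.GaloisRepresentations.LocalMuNCocycleSubgroupSplitting
import Literature.NumberTheory.IwasawaTheory.WeakLeopoldtCyclotomicStages
import Literature.NumberTheory.EllipticCurves.IwasawaCyclotomicProofs
import HarnessLib

/-!
# Local degrees grow `p`-divisibly up the cyclotomic tower: for a finite place `v` of a number field `F`,
# `p^k ∣ n_v(E′/F)` as soon as `E′ ∋ ζ_{p^M}` (`M ≫ 0`), and `n_v(E/F) ∣ n_v(E′/F)` in towers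
# (Serre, *Cohomologie galoisienne* II §4.4 Lemme 1; NSW (8.3.11), proof: «the local degrees of `k_S ⊇ k(μ_{p^∞})`
# at the primes of `S` are divisible by `p^∞`»)

Topic `NumberTheory/GaloisRepresentations`; namespace `Literature.NumberTheory.GaloisRepresentations.IdeleCohomology`
(the currency `localDegree E v = n_v = [E_w : F_v] = #G_w` of `IdeleLocalInvariantsRange.lean`).  THEOREMS ONLY (no
definition, no named fact, no `sorry`, no instance); number fields in `Type`.  Cell `bsd-eis`, lane «PT3-TC»
(Harari Thm. 17.13 (a) at totally complex fields via NSW (8.3.18)), the «cyc-degree / `hdeg`» brick: the arithmetic input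
of the finite-layer diagram chase NSW (8.3.11) (iii)/(iv) (brick (A3d) of width seat w7 gen 8, hypothesis
`hdeg : ∀ v ∈ S, p ^ k * localDegree E v ∣ localDegree E′ v`) and of the colimit plumbing (A2)/(A5) (width seat w8 gen 9),
which only has to exhibit a layer `E′ = E(μ_{p^M}) ⊆ K_S` with a primitive `p^M`-th root of unity.

Mathematics.  (1) TOWERS: for finite Galois `E ⊆ E′` over `F` and `w′ ∣ w ∣ v`, `E_w ↪ E′_{w′}` over `F_v` (tree
`SemiLocal.inflAlgHom`), so `n_v(E) = [E_w : F_v]` divides `n_v(E′) = [E′_{w′} : F_v]`.  (2) GROWTH (Serre II §4.4 Lemme 1,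
Greenberg LNM 1716 §1: in the cyclotomic `ℤ_p`-tower every finite place has local degree `p^∞`): the tree proves that the
local layer subgroups `res_v⁻¹(κ⁻¹(p^m ℤ_p)) ≤ Γ_{F_v}` of the cyclotomic `ℤ_p`-extension `κ` have index divisible by `p^k`
for `m ≫ 0` (`exists_pow_dvd_index_comap_resGal_of_ne_one`, fed by `exists_apply_resGal_ne_one_of_isCyclotomic'`), and that
`Gal(F̄/F(ζ_{p^M})) = ker χ̄_{p^M} ≤ κ⁻¹(p^m ℤ_p)` for `M ≫ m` (`IwasawaTheory.exists_forall_ker_modNCyclotomicCharacter_le_layerSubgroup`);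
if `E ∋ ζ_{p^M}`, the subgroup `Gal(F̄_v/F_v(E))` fixing the compositum `F_v(E) ⊆ F̄_v` (`≃ E_w`, tree
`SemiLocal.compositumAlgEquivPlace`; index `= [E_w : F_v] = n_v(E)`) restricts into `ker χ̄_{p^M}`, hence into the layer
subgroup, and `p^k ∣ n_v(E)` by comparison of indices.  (3) With `n = n_v(E)`, `N = n_v(E′)`: `n ∣ N` and
`p^{k + v_p(n)} ∣ N` give `p^k · n ∣ N`.

## What is formalised
* §1 `localDegree_dvd_localDegree_of_tower` — `localDegree E v ∣ localDegree E′ v` for `F ⊆ E ⊆ E′`.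
* §2 `index_galFixing_compositum_eq_localDegree` (`(Γ_{F_v} : Gal(F̄_v/F_v(E))) = n_v(E)`),
  **`exists_forall_pow_dvd_localDegree`** — `∃ M₀, ∀ M ≥ M₀, ∀ E/F` finite Galois with a primitive `p^M`-th root of unity,
  `p ^ k ∣ localDegree E v`.
* §3 (a private arithmetic lemma) and the packaged supplier
  **`exists_forall_pow_mul_localDegree_dvd`**: for `E/F` finite Galois, `S` finite, `k`: `∃ M₀, ∀ M ≥ M₀`, every finite Galois
  `E′ ⊇ E` over `F` containing a primitive `p^M`-th root of unity has `p ^ k * localDegree E v ∣ localDegree E′ v` for all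
  `v ∈ S` — the `hdeg` of (A3d).

HONEST FRAMING: local-degree bookkeeping from tree theorems; no statement of any summit, no Poitou–Tate theorem is proved here.

## References
* J.-P. Serre, *Cohomologie galoisienne* / *Galois Cohomology* (1997), II §4.4 Prop. 13, Lemme 1. [SerreGaloisCohomology1997]
* J. Neukirch, A. Schmidt, K. Wingberg, *Cohomology of Number Fields*, 2nd ed. (2008), VIII §3, proof of (8.3.11); X §3 (10.3.25).
  [NeukirchSchmidtWingberg2008]
* R. Greenberg, *Iwasawa theory for elliptic curves*, LNM 1716 (1999), §1. [GreenbergLNM1716]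
* J. W. S. Cassels, A. Fröhlich (eds.), *Algebraic Number Theory* (1967), Ch. II §10, Ch. VII §1.1. [CasselsFrohlichANT1967]
-/

noncomputable section

open NumberField IsDedekindDomain Field
open Literature.NumberTheory.Automorphic

namespace Literature.NumberTheory.GaloisRepresentations

namespace IdeleCohomology

open Literature.NumberTheory.GaloisRepresentations.SemiLocal Literature.NumberTheory.EllipticCurves
  Literature.NumberTheory.IwasawaTheory Literature.NumberTheory.GaloisRepresentations.LocalWeilDatum

variable {F : Type} [Field F] [NumberField F]

/-! ## §1. Towers: `n_v(E) ∣ n_v(E′)` -/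

/-- **In a tower `F ⊆ E ⊆ E′` of finite Galois extensions, `n_v(E/F) ∣ n_v(E′/F)`** at every finite place `v` of `F`:
`E_w ↪ E′_{w′}` over `F_v` (`w = w′ ∩ E`), so `[E_w : F_v] ∣ [E′_{w′} : F_v]`.
[cite: CasselsFrohlichANT1967, Ch. II §10, Ch. VII §1.1] -/
theorem localDegree_dvd_localDegree_of_tower {E E' : Type} [Field E] [NumberField E] [Field E'] [NumberField E']
    [Algebra F E] [Algebra E E'] [Algebra F E'] [IsScalarTower F E E'] [IsGalois F E] [IsGalois F E']
    (v : HeightOneSpectrum (𝓞 F)) : localDegree E v ∣ localDegree E' v := by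
  set w' : Place F E' v := chosenPlace (E := E') v
  set w : Place F E v := Place.below w'
  haveI := finiteDimensional_place (K := F) w'
  haveI := finiteDimensional_place (K := F) w
  rw [localDegree_eq_finrank w, localDegree_eq_finrank w']
  -- the image `L` of `E_w` in `E′_{w′}` is an intermediate field with `[L : F_v] = [E_w : F_v]`
  set f := SemiLocal.inflAlgHom (F := F) (E := E) (E' := E') w'
  let L : IntermediateField (v.adicCompletion F) ((w' : HeightOneSpectrum (𝓞 E')).adicCompletion E') := f.fieldRange
  have hL : Module.finrank (v.adicCompletion F) L =
      Module.finrank (v.adicCompletion F) ((w : HeightOneSpectrum (𝓞 E)).adicCompletion E) :=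
    (AlgEquiv.ofInjectiveField f).toLinearEquiv.finrank_eq.symm
  rw [← hL]
  exact Dvd.intro _ (Module.finrank_mul_finrank (v.adicCompletion F) L
    ((w' : HeightOneSpectrum (𝓞 E')).adicCompletion E'))

/-! ## §2. Growth: `p^k ∣ n_v(E)` once `E ∋ ζ_{p^M}`, `M ≫ 0` -/

variable (p : ℕ) [hp : Fact p.Prime]

/-- **`(Γ_{F_v} : Gal(F̄_v / F_v(E))) = n_v(E)`**: the subgroup of `Γ_{F_v}` fixing the compositum `F_v(E) ⊆ F̄_v` of `F_v` and an
`F`-embedded copy of `E` has index `[F_v(E) : F_v] = [E_w : F_v]` (`F_v(E) ≃ E_w`, `F_v(E)/F_v` Galois).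
[cite: CasselsFrohlichANT1967, Ch. II §10, Ch. VII §1.1] -/
theorem index_galFixing_compositum_eq_localDegree {E : Type} [Field E] [NumberField E] [Algebra F E] [IsGalois F E]
    (ιE : E →ₐ[F] AlgebraicClosure F) (v : HeightOneSpectrum (𝓞 F)) :
    (galFixing (v.adicCompletion F) (compositum ιE v)).index = localDegree E v := by
  set w : Place F E v := chosenPlace (E := E) v
  haveI := finiteDimensional_place (K := F) w
  haveI : FiniteDimensional (v.adicCompletion F) (compositum ιE v) :=
    LinearEquiv.finiteDimensional (compositumAlgEquivPlace ιE w).symm.toLinearEquiv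
  haveI := isGalois_compositum ιE w
  rw [localDegree_eq_finrank w, ← (compositumAlgEquivPlace ιE w).toLinearEquiv.finrank_eq,
    ← IsGalois.card_aut_eq_finrank, ← ker_resGal, Subgroup.index_ker,
    MonoidHom.range_eq_top.mpr (resGal_surjective (compositum ιE v)), Subgroup.card_top]

/-- **Local degrees grow `p`-divisibly up the cyclotomic tower.**  For every finite place `v` of `F` and every `k`
there is `M₀` such that every finite Galois `E/F` containing a primitive `p^M`-th root of unity, `M ≥ M₀`, has
`p ^ k ∣ n_v(E) = localDegree E v`.  (The local layers `res_v⁻¹(κ⁻¹(p^m ℤ_p))` of the cyclotomic `ℤ_p`-extension `κ`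
have index divisible by `p^k` for `m ≫ 0`, `Gal(F̄/F(ζ_{p^M})) ≤ κ⁻¹(p^m ℤ_p)` for `M ≫ m`, and `Gal(F̄_v/F_v(E))`
restricts into `Gal(F̄/F(ζ_{p^M}))` when `ζ_{p^M} ∈ E`.) [cite: SerreGaloisCohomology1997, II §4.4 Lemme 1]
[cite: NeukirchSchmidtWingberg2008, VIII §3 (8.3.11) (proof)] [cite: GreenbergLNM1716, §1] -/
theorem exists_forall_pow_dvd_localDegree (v : HeightOneSpectrum (𝓞 F)) (k : ℕ) :
    ∃ M₀ : ℕ, ∀ M : ℕ, M₀ ≤ M → ∀ (E : Type) [Field E] [NumberField E] [Algebra F E] [IsGalois F E]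
      (ζ : E), IsPrimitiveRoot ζ (p ^ M) → p ^ k ∣ localDegree E v := by
  have hpp : p.Prime := hp.out
  -- the cyclotomic `ℤ_p`-extension and its local layers at `v`
  obtain ⟨κ, hκ⟩ := exists_cyclotomicZpExtension_holds F p
  obtain ⟨m₀, hm₀⟩ := exists_pow_dvd_index_comap_resGal_of_ne_one F p κ.toContinuousMonoidHom v
    (exists_apply_resGal_ne_one_of_isCyclotomic' F p hκ v) k
  -- `ker χ̄_{p^M} ≤ κ⁻¹(p^{m₀} ℤ_p)` for `M ≥ M₀`
  obtain ⟨M₀, hM₀⟩ := exists_forall_ker_modNCyclotomicCharacter_le_layerSubgroup p hκ m₀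
  refine ⟨M₀, fun M hM E _ _ _ _ ζ hζ => ?_⟩
  haveI : NeZero (p ^ M) := ⟨pow_ne_zero _ hpp.ne_zero⟩
  -- an `F`-embedding of `E` into `F̄` and the compositum `F_v(E) ⊆ F̄_v`
  let ιE : E →ₐ[F] AlgebraicClosure F := IsAlgClosed.lift
  set ζ' : AlgebraicClosure F := ιE ζ with hζ'
  have hζ'p : IsPrimitiveRoot ζ' (p ^ M) := hζ.map_of_injective ιE.injective
  -- `Gal(F̄_v/F_v(E))` restricts into `ker χ̄_{p^M} ≤ κ⁻¹(p^{m₀} ℤ_p)`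
  have hle : galFixing (v.adicCompletion F) (compositum ιE v) ≤
      (κ.layerSubgroup m₀).comap
        ((absGaloisRestrict F (v.adicCompletion F) :
          absoluteGaloisGroup (v.adicCompletion F) →ₜ* absoluteGaloisGroup F) :
            absoluteGaloisGroup (v.adicCompletion F) →* absoluteGaloisGroup F) := by
    intro d hd
    rw [Subgroup.mem_comap]
    refine hM₀ M hM ?_
    rw [MonoidHom.mem_ker]
    refine modNCyclotomicCharacter_eq_one_of_mem_fixingSubgroup F (p ^ M) hζ'p _ ?_
    -- `res d` fixes `ζ'`, hence `F(ζ')`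
    have hfix : absGaloisRestrict F (v.adicCompletion F) d • ζ' = ζ' := by
      apply (absClosureEmbedding F (v.adicCompletion F)).injective
      change absClosureEmbedding F (v.adicCompletion F) (absGaloisRestrict F (v.adicCompletion F) d • ζ') =
        absClosureEmbedding F (v.adicCompletion F) ζ'
      rw [absGaloisRestrict_apply_smul]
      exact (mem_galFixing_iff (F := v.adicCompletion F)).mp hd _ (mem_compositum v ιE ζ)
    intro x
    exact smul_eq_self_of_mem_adjoin F (S := {ζ'}) (fun z hz => by rw [Set.mem_singleton_iff.mp hz]; exact hfix) x.2
  -- compare indices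
  have hidx : p ^ k ∣ ((κ.layerSubgroup m₀).comap
      ((absGaloisRestrict F (v.adicCompletion F) :
        absoluteGaloisGroup (v.adicCompletion F) →ₜ* absoluteGaloisGroup F) :
          absoluteGaloisGroup (v.adicCompletion F) →* absoluteGaloisGroup F)).index :=
    hm₀ m₀ le_rfl
  rw [← index_galFixing_compositum_eq_localDegree ιE v]
  exact hidx.trans (Subgroup.index_dvd_of_le hle)

/-! ## §3. The packaged supplier `hdeg` -/

omit [Field F] [NumberField F] hp in
/-- Arithmetic: `n ∣ N` and `p^{k + v_p(n)} ∣ N` give `p^k · n ∣ N` (`n = p^{v_p(n)} n′`, `p ∤ n′`). [folklore] -/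
private theorem pow_mul_dvd_of_dvd_of_pow_add_factorization_dvd (hpp : p.Prime) {n N k : ℕ} (hn : n ≠ 0) (h1 : n ∣ N)
    (h2 : p ^ (k + n.factorization p) ∣ N) : p ^ k * n ∣ N := by
  obtain ⟨r, rfl⟩ := h1
  set a := n.factorization p with ha
  have hdec : p ^ a * (n / p ^ a) = n := Nat.ordProj_mul_ordCompl_eq_self n p
  have hnd : ¬ p ∣ n / p ^ a := Nat.not_dvd_ordCompl hpp hn
  -- `p^k ∣ (n / p^a) * r`
  have h3 : p ^ k ∣ (n / p ^ a) * r := by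
    have h4 : p ^ a * p ^ k ∣ p ^ a * ((n / p ^ a) * r) := by
      rw [← pow_add, add_comm, ← mul_assoc, hdec]
      exact h2
    exact Nat.dvd_of_mul_dvd_mul_left (pow_pos hpp.pos a) h4
  have h5 : p ^ k ∣ r :=
    (Nat.Coprime.pow_left k ((Nat.Prime.coprime_iff_not_dvd hpp).mpr hnd)).dvd_of_dvd_mul_left h3
  obtain ⟨s, rfl⟩ := h5
  exact ⟨s, by ring⟩

/-- **The `hdeg` supplier of NSW (8.3.11).**  For a finite Galois `E/F`, a finite set `S` of finite places of `F` and `k`,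
there is `M₀` such that every finite Galois `E′/F` with `E ⊆ E′` containing a primitive `p^M`-th root of unity, `M ≥ M₀`,
satisfies `p ^ k * localDegree E v ∣ localDegree E′ v` for every `v ∈ S` (towers: `n_v(E) ∣ n_v(E′)`; growth at the
exponent `k + v_p(n_v(E))`, uniformly in `v ∈ S` by taking the maximum). [cite: NeukirchSchmidtWingberg2008, VIII §3 (8.3.11) (proof)]
[cite: SerreGaloisCohomology1997, II §4.4 Lemme 1] -/
theorem exists_forall_pow_mul_localDegree_dvd (E : Type) [Field E] [NumberField E] [Algebra F E] [IsGalois F E]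
    (S : Finset (HeightOneSpectrum (𝓞 F))) (k : ℕ) :
    ∃ M₀ : ℕ, ∀ M : ℕ, M₀ ≤ M → ∀ (E' : Type) [Field E'] [NumberField E'] [Algebra F E'] [Algebra E E']
      [IsScalarTower F E E'] [IsGalois F E'] (ζ : E'), IsPrimitiveRoot ζ (p ^ M) →
      ∀ v ∈ S, p ^ k * localDegree E v ∣ localDegree E' v := by
  classical
  have hpp : p.Prime := hp.out
  -- per place, the threshold of §2 at the exponent `k + v_p(n_v(E))`
  have hv : ∀ v : HeightOneSpectrum (𝓞 F), ∃ M₀ : ℕ, ∀ M : ℕ, M₀ ≤ M →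
      ∀ (E' : Type) [Field E'] [NumberField E'] [Algebra F E'] [IsGalois F E'] (ζ : E'), IsPrimitiveRoot ζ (p ^ M) →
        p ^ (k + (localDegree E v).factorization p) ∣ localDegree E' v :=
    fun v => exists_forall_pow_dvd_localDegree p v (k + (localDegree E v).factorization p)
  choose Mf hMf using hv
  refine ⟨S.sup Mf, fun M hM E' _ _ _ _ _ _ ζ hζ v hvS => ?_⟩
  have hn : localDegree E v ≠ 0 := (localDegree_pos (E := E) v).ne'
  exact pow_mul_dvd_of_dvd_of_pow_add_factorization_dvd p hpp hn (localDegree_dvd_localDegree_of_tower v)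
    (hMf v M ((Finset.le_sup hvS).trans hM) E' ζ hζ)

end IdeleCohomology

end Literature.NumberTheory.GaloisRepresentations

end
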